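import Literature.NumberTheory.EllipticCurves.Fisher2012.ThreeTorsionFracLinearTransfer
import HarnessLib

/-!
# A torsion-line `3`-torsion transfer datum gives a `Γ_K`-equivariant `E[3] ≃ E'[3]`
# (file R1 of the cell `b2b-bsdres` discharge of the `X_E^-(3)` analogue of Fisher 2012 Thm. 13.2,
# `n = 3`; seat n1011-p02 gen 8, 'T-F132-3R'; sibling of `ThreeTorsionFracLinearTransfer` (file F3))

HONEST FRAMING (cell `b2b-bsdres`, run/shared/lean/b2b/bsd-rank1-residual/, verbatim in every
file): the goal of the cell is to DELETE the COMBINATION-SHAPED residual classes of the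
Birch–Swinnerton-Dyer formula for ALL analytic-rank `≤ 1` elliptic curves over `ℚ` — "full BSD
formula for every rank `≤ 1` curve in class `C`" assembled STRICTLY from published theorems — so
that the rank-`≤ 1` remainder becomes exactly the CONSTRUCTION-SHAPED classes, which are TYPED
(missing-input `Prop`s), NOT attempted. This is not "finishing BSD". This file: a TOOL theorem of
our formalisation of a published statement; no definition, no named fact.

## What this file proves

`threeCongruent_of_torsionLineDatum`: let `W, W'` be elliptic curves over a field `K` of
characteristic `0`, `W` SHORT (`a₁ = a₂ = a₃ = 0`, so `E : y² = x³ + Ax + B`) and `W'` with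
`a₁ = a₃ = 0`; let `N, D ∈ K[X]` and `c ∈ K`, `c ≠ 0`, such that over `K̄`: the denominator `D`
does not vanish at the roots of `Ψ₃^{W}`; `x ↦ N(x)/D(x)` is injective on those roots and carries
them to roots of `Ψ₃^{W'}`; every point `(x, y)` of `W` with `Ψ₃^{W}(x) = 0` is carried by
`f : (x, y) ↦ (N(x)/D(x), c·y/D(x))` onto `W'`; and the TORSION-LINE condition: for all `s, t ∈ K̄`
with `s⁴ + 2st + A = 0` and `2s³t + t² − As² + 3B = 0` there are `s', t' ∈ K̄` with
`c·(sx + t) = s'·N(x) + t'·D(x)` for every root `x` of `Ψ₃^{W}` with `x³ + Ax + B = (sx + t)²`.  Then there is an additive isomorphism `E[3] ≃ E'[3]` of the geometric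
`3`-torsion commuting with `Γ_K`.

Why the torsion-line condition is the right one (proved inside, `torsionLine_relations`): if
`P = (x₁, y₁)`, `Q = (x₂, y₂)` are points of order `3` of `E` with `x₁ ≠ x₂`, the third point
`R = −(P + Q) = (x₃, y₃)` of the line `PQ : y = sx + t` has order `3` too, the three abscissae are
DISTINCT roots of `Ψ₃ = 3X⁴ + 6AX² + 12BX − A²` and of `X³ + AX + B − (sX + t)²`, so the
remainder `Ψ₃ − (3X + 3s²)(X³ + AX + B − (sX + t)²) = 3(s⁴ + 2st + A)X² + 3(2s³t + t² − As² + 3B)X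
+ (3s²t² − 3Bs² − A²)`, a quadratic with three distinct roots, vanishes identically: the slope and
intercept of each of the eight `3`-torsion lines of `E` missing `O` satisfy `s² = −x₄`, `2st =
−(x₄² + A)` for the omitted root `x₄` of `Ψ₃`.  Under the condition the three image points lie on the
line `y' = s'x' + t'` of the plane of `W'`, so they are collinear and (file F1,
`add_eq_neg_of_collinear`, Silverman *AEC* III.2.3) `f P + f Q = −f R = f (P + Q)`.  The rest —
`f` is defined on `E[3]`, lands in `E'[3]`, is odd, `Γ_K`-equivariant, injective, hence bijective as
`#E[3] = #E'[3] = 9` — is as in file F3 (`threeCongruent_of_fracLinearDatum`), whose projective-linear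
datum is the special case `deg N, deg D ≤ 1` (there collinearity is automatic).  The reverse
(`X_E^-(3)`) family of Fisher needs `deg N = deg D = 3`: the underlying correspondence is the
correlation "flex ↦ harmonic polar", not a collineation (files R2, R3).

References: [Fisher2012Hessian] §13 (the `X_E^-(n)` analogue of Thm. 13.2); [SilvermanAEC2009]
III.2.3, Cor. III.6.4, Ex. 3.7.
-/

noncomputable section

open scoped Classical

open WeierstrassCurve Polynomial Literature.NumberTheory.EllipticCurves

namespace Literature.NumberTheory.EllipticCurves.Fisher2012

universe u

section Lemmas

variable {F : Type*} [Field F]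

/-- `Ψ₃` of a short model (`a₁ = a₂ = a₃ = 0`), evaluated: `3x⁴ + 6a₄x² + 12a₆x − a₄²`. [folklore] -/
private theorem eval_Ψ₃_of_short (V : WeierstrassCurve F) (h1 : V.a₁ = 0) (h2 : V.a₂ = 0)
    (h3 : V.a₃ = 0) (x : F) :
    V.Ψ₃.eval x = 3 * x ^ 4 + 6 * V.a₄ * x ^ 2 + 12 * V.a₆ * x - V.a₄ ^ 2 := by
  simp only [WeierstrassCurve.Ψ₃, WeierstrassCurve.b₂, WeierstrassCurve.b₄, WeierstrassCurve.b₆,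
    WeierstrassCurve.b₈, h1, h2, h3, eval_add, eval_mul, eval_pow, eval_C, eval_X, eval_ofNat]
  ring

/-- The affine equation of a short model: `y² = x³ + a₄x + a₆`. [folklore] -/
private theorem equation_of_short (V : WeierstrassCurve F) (h1 : V.a₁ = 0) (h2 : V.a₂ = 0)
    (h3 : V.a₃ = 0) {x y : F} (h : V.toAffine.Equation x y) : x ^ 3 + V.a₄ * x + V.a₆ = y ^ 2 := by
  rw [WeierstrassCurve.Affine.equation_iff] at h
  rw [show V.toAffine.a₁ = V.a₁ from rfl, show V.toAffine.a₂ = V.a₂ from rfl,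
    show V.toAffine.a₃ = V.a₃ from rfl, h1, h2, h3] at h
  linear_combination -h

/-- A quadratic `αX² + βX + γ` with three distinct roots is zero. [folklore] -/
private theorem quad_coeff_eq_zero {α β γ x₁ x₂ x₃ : F} (h12 : x₁ ≠ x₂) (h13 : x₁ ≠ x₃)
    (h23 : x₂ ≠ x₃) (e1 : α * x₁ ^ 2 + β * x₁ + γ = 0) (e2 : α * x₂ ^ 2 + β * x₂ + γ = 0)
    (e3 : α * x₃ ^ 2 + β * x₃ + γ = 0) : α = 0 ∧ β = 0 ∧ γ = 0 := by
  have d12 : α * (x₁ + x₂) + β = 0 := by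
    have h : (x₁ - x₂) * (α * (x₁ + x₂) + β) = 0 := by linear_combination e1 - e2
    exact (mul_eq_zero.mp h).resolve_left (sub_ne_zero.mpr h12)
  have d13 : α * (x₁ + x₃) + β = 0 := by
    have h : (x₁ - x₃) * (α * (x₁ + x₃) + β) = 0 := by linear_combination e1 - e3
    exact (mul_eq_zero.mp h).resolve_left (sub_ne_zero.mpr h13)
  have hα : α = 0 := by
    have h : (x₂ - x₃) * α = 0 := by linear_combination d12 - d13
    exact (mul_eq_zero.mp h).resolve_left (sub_ne_zero.mpr h23)
  have hβ : β = 0 := by rw [hα, zero_mul, zero_add] at d12; exact d12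
  refine ⟨hα, hβ, ?_⟩
  rw [hα, hβ, zero_mul, zero_mul, zero_add, zero_add] at e1
  exact e1

/-- **The relations of a `3`-torsion line.**  On `E : y² = x³ + Ax + B` let `y = sx + t` pass
through three points `(xᵢ, sxᵢ + t)` of `E` whose abscissae are DISTINCT roots of
`Ψ₃ = 3X⁴ + 6AX² + 12BX − A²`.  Then `s⁴ + 2st + A = 0`, `2s³t + t² − As² + 3B = 0` and
`3s⁸ + 6As⁴ − 12Bs² − A² = 0` (so `x₄ := −s²` is the fourth root of `Ψ₃` and `2st = −(x₄² + A)`).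
[cite: SilvermanAEC2009, III.2.3 and Ex. 3.7 (Ψ₃; the line through three points of E)] -/
theorem torsionLine_relations {A B s t x₁ x₂ x₃ : F} (h3 : (3 : F) ≠ 0) (h12 : x₁ ≠ x₂)
    (h13 : x₁ ≠ x₃) (h23 : x₂ ≠ x₃)
    (hψ₁ : 3 * x₁ ^ 4 + 6 * A * x₁ ^ 2 + 12 * B * x₁ - A ^ 2 = 0)
    (hψ₂ : 3 * x₂ ^ 4 + 6 * A * x₂ ^ 2 + 12 * B * x₂ - A ^ 2 = 0)
    (hψ₃ : 3 * x₃ ^ 4 + 6 * A * x₃ ^ 2 + 12 * B * x₃ - A ^ 2 = 0)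
    (hq₁ : x₁ ^ 3 + A * x₁ + B = (s * x₁ + t) ^ 2) (hq₂ : x₂ ^ 3 + A * x₂ + B = (s * x₂ + t) ^ 2)
    (hq₃ : x₃ ^ 3 + A * x₃ + B = (s * x₃ + t) ^ 2) :
    s ^ 4 + 2 * s * t + A = 0 ∧ 2 * s ^ 3 * t + t ^ 2 - A * s ^ 2 + 3 * B = 0 ∧
      3 * s ^ 8 + 6 * A * s ^ 4 - 12 * B * s ^ 2 - A ^ 2 = 0 := by
  have e : ∀ {x : F}, 3 * x ^ 4 + 6 * A * x ^ 2 + 12 * B * x - A ^ 2 = 0 →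
      x ^ 3 + A * x + B = (s * x + t) ^ 2 →
      3 * (s ^ 4 + 2 * s * t + A) * x ^ 2 + 3 * (2 * s ^ 3 * t + t ^ 2 - A * s ^ 2 + 3 * B) * x
        + (3 * s ^ 2 * t ^ 2 - 3 * B * s ^ 2 - A ^ 2) = 0 := by
    intro x hψ hq
    linear_combination hψ - (3 * x + 3 * s ^ 2) * hq
  obtain ⟨hα, hβ, hγ⟩ := quad_coeff_eq_zero h12 h13 h23 (e hψ₁ hq₁) (e hψ₂ hq₂) (e hψ₃ hq₃)
  have L1 : s ^ 4 + 2 * s * t + A = 0 := (mul_eq_zero.mp hα).resolve_left h3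
  have L2 : 2 * s ^ 3 * t + t ^ 2 - A * s ^ 2 + 3 * B = 0 := (mul_eq_zero.mp hβ).resolve_left h3
  refine ⟨L1, L2, ?_⟩
  linear_combination hγ - 3 * s ^ 2 * L2 + 3 * s ^ 4 * L1

/-- In `E[3]`, `P + P = −P`. [folklore] -/
private theorem add_self_eq_neg_of_three_smul' {G : Type*} [AddCommGroup G] {P : G}
    (h : (3 : ℤ) • P = 0) : P + P = -P := by
  rw [← sub_eq_zero, sub_neg_eq_add]
  have : (3 : ℤ) • P = P + P + P := by
    rw [show (3 : ℤ) = 1 + 1 + 1 by norm_num, add_zsmul, add_zsmul, one_zsmul]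
  rw [← this, h]

/-- In `E[3]`: `−(P + Q) = P` forces `Q = P`. [folklore] -/
private theorem eq_of_neg_add_eq_left' {G : Type*} [AddCommGroup G] {P Q : G} (hP : (3 : ℤ) • P = 0)
    (h : -(P + Q) = P) : Q = P := by
  have h' : P + Q = -P := by
    have := congrArg Neg.neg h
    simpa only [neg_neg] using this
  have e : Q = -P - P := by
    rw [eq_sub_iff_add_eq, add_comm]
    exact h'
  rw [e, sub_eq_add_neg, ← neg_add, add_self_eq_neg_of_three_smul' hP, neg_neg]

/-- In any group: `−(P + Q) = −P` forces `Q = 0`. [folklore] -/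
private theorem eq_zero_of_neg_add_eq_neg_left' {G : Type*} [AddCommGroup G] {P Q : G}
    (h : -(P + Q) = -P) : Q = 0 := by
  rw [neg_inj, add_eq_left] at h
  exact h

end Lemmas

/-! ### The transfer theorem -/

section Transfer

variable {K : Type u} [Field K]

/-- `τ (aeval x N / aeval x D) = aeval (τ x) N / aeval (τ x) D` for `N D ∈ K[X]`, `τ ∈ Aut(K̄/K)`.
[folklore] -/
private theorem algEquiv_aeval_div (τ : (AlgebraicClosure K) ≃ₐ[K] (AlgebraicClosure K)) (N D : K[X])
    (x : AlgebraicClosure K) :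
    τ (aeval x N / aeval x D) = aeval (τ x) N / aeval (τ x) D := by
  rw [map_div₀, show τ (aeval x N) = (τ : (AlgebraicClosure K) →ₐ[K] (AlgebraicClosure K)) (aeval x N)
    from rfl, show τ (aeval x D) = (τ : (AlgebraicClosure K) →ₐ[K] (AlgebraicClosure K)) (aeval x D)
    from rfl, ← Polynomial.aeval_algHom_apply, ← Polynomial.aeval_algHom_apply]
  rfl

/-- `τ (c y / aeval x D) = c (τ y) / aeval (τ x) D` for `c ∈ K`, `D ∈ K[X]`, `τ ∈ Aut(K̄/K)`.
[folklore] -/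
private theorem algEquiv_smul_div (τ : (AlgebraicClosure K) ≃ₐ[K] (AlgebraicClosure K)) (c : K) (D : K[X])
    (x y : AlgebraicClosure K) :
    τ (algebraMap K (AlgebraicClosure K) c * y / aeval x D) =
      algebraMap K (AlgebraicClosure K) c * τ y / aeval (τ x) D := by
  rw [map_div₀, map_mul, AlgEquiv.commutes, show τ (aeval x D) =
    (τ : (AlgebraicClosure K) →ₐ[K] (AlgebraicClosure K)) (aeval x D) from rfl,
    ← Polynomial.aeval_algHom_apply]
  rfl

/-- `Ψ₃` of `W/K̄` has coefficients in `K`: its root set is `Aut(K̄/K)`-stable. [folklore] -/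
private theorem eval_Ψ₃_baseChange_algEquiv' (W : WeierstrassCurve K)
    (τ : (AlgebraicClosure K) ≃ₐ[K] (AlgebraicClosure K)) (x : AlgebraicClosure K) :
    (W.baseChange (AlgebraicClosure K)).Ψ₃.eval (τ x) =
      τ ((W.baseChange (AlgebraicClosure K)).Ψ₃.eval x) := by
  have hΨK : ∀ z : AlgebraicClosure K, (W.baseChange (AlgebraicClosure K)).Ψ₃.eval z =
      Polynomial.aeval z W.Ψ₃ := fun z => by
    rw [WeierstrassCurve.baseChange, WeierstrassCurve.map_Ψ₃, Polynomial.eval_map,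
      ← Polynomial.aeval_def]
  rw [hΨK, hΨK, show τ x = (τ : (AlgebraicClosure K) →ₐ[K] (AlgebraicClosure K)) x from rfl,
    Polynomial.aeval_algHom_apply]
  rfl

variable [CharZero K] (W W' : WeierstrassCurve K) [W.IsElliptic] [W'.IsElliptic]

/-- **A torsion-line `3`-torsion transfer datum gives `E[3] ≅ E'[3]` as `Γ_K`-modules.**
See the module docstring. [cite: Fisher2012Hessian, §13 (analogue of Thm. 13.2 for X_E^-(3), n = 3)]
[cite: SilvermanAEC2009, III.2.3 and Cor. III.6.4] -/
theorem threeCongruent_of_torsionLineDatum (hW1 : W.a₁ = 0) (hW2 : W.a₂ = 0) (hW3 : W.a₃ = 0)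
    (hW'1 : W'.a₁ = 0) (hW'3 : W'.a₃ = 0) (N D : K[X]) (c : K) (hc : c ≠ 0)
    (hden : ∀ x : AlgebraicClosure K, (W.baseChange (AlgebraicClosure K)).Ψ₃.eval x = 0 →
      aeval x D ≠ 0)
    (hinj : ∀ x₁ x₂ : AlgebraicClosure K, (W.baseChange (AlgebraicClosure K)).Ψ₃.eval x₁ = 0 →
      (W.baseChange (AlgebraicClosure K)).Ψ₃.eval x₂ = 0 →
      aeval x₁ N / aeval x₁ D = aeval x₂ N / aeval x₂ D → x₁ = x₂)
    (hΨ : ∀ x : AlgebraicClosure K, (W.baseChange (AlgebraicClosure K)).Ψ₃.eval x = 0 →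
      (W'.baseChange (AlgebraicClosure K)).Ψ₃.eval (aeval x N / aeval x D) = 0)
    (hEq : ∀ x y : AlgebraicClosure K, (W.baseChange (AlgebraicClosure K)).toAffine.Equation x y →
      (W.baseChange (AlgebraicClosure K)).Ψ₃.eval x = 0 →
      (W'.baseChange (AlgebraicClosure K)).toAffine.Equation (aeval x N / aeval x D)
        (algebraMap K (AlgebraicClosure K) c * y / aeval x D))
    (hline : ∀ s t : AlgebraicClosure K,
      s ^ 4 + 2 * s * t + (W.baseChange (AlgebraicClosure K)).a₄ = 0 →
      2 * s ^ 3 * t + t ^ 2 - (W.baseChange (AlgebraicClosure K)).a₄ * s ^ 2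
        + 3 * (W.baseChange (AlgebraicClosure K)).a₆ = 0 →
      ∃ s' t' : AlgebraicClosure K, ∀ x : AlgebraicClosure K,
        (W.baseChange (AlgebraicClosure K)).Ψ₃.eval x = 0 →
        x ^ 3 + (W.baseChange (AlgebraicClosure K)).a₄ * x + (W.baseChange (AlgebraicClosure K)).a₆
          = (s * x + t) ^ 2 →
        algebraMap K (AlgebraicClosure K) c * (s * x + t) = s' * aeval x N + t' * aeval x D) :
    ∃ f : geomTorsion W (3 : ℤ) ≃+ geomTorsion W' (3 : ℤ),
      ∀ (σ : Field.absoluteGaloisGroup K) (P : geomTorsion W (3 : ℤ)), f (σ • P) = σ • f P := by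
  -- shorthands (everything at the level of Mathlib points of `W/K̄`, `W'/K̄`)
  set V := W.baseChange (AlgebraicClosure K) with hV
  set V' := W'.baseChange (AlgebraicClosure K) with hV'
  have hV1 : V.a₁ = 0 := by simp [hV, WeierstrassCurve.baseChange, hW1]
  have hV2 : V.a₂ = 0 := by simp [hV, WeierstrassCurve.baseChange, hW2]
  have hV3 : V.a₃ = 0 := by simp [hV, WeierstrassCurve.baseChange, hW3]
  have hc' : algebraMap K (AlgebraicClosure K) c ≠ 0 := (_root_.map_ne_zero _).mpr hc
  have negY_V : ∀ x y : AlgebraicClosure K, V.toAffine.negY x y = -y := fun x y => by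
    simp [Affine.negY, hV, WeierstrassCurve.baseChange, hW1, hW3]
  have negY_V' : ∀ x y : AlgebraicClosure K, V'.toAffine.negY x y = -y := fun x y => by
    simp [Affine.negY, hV', WeierstrassCurve.baseChange, hW'1, hW'3]
  -- the map on coordinates
  set X' : AlgebraicClosure K → AlgebraicClosure K := fun x => aeval x N / aeval x D with hX'
  set Y' : AlgebraicClosure K → AlgebraicClosure K → AlgebraicClosure K :=
    fun x y => algebraMap K (AlgebraicClosure K) c * y / aeval x D with hY'
  have Y'_neg : ∀ x y, Y' x (-y) = -Y' x y := fun x y => by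
    simp only [hY', mul_neg, neg_div]
  -- nonsingularity of the image of a `3`-division point
  have himNS : ∀ {x y : AlgebraicClosure K}, V.toAffine.Nonsingular x y → V.Ψ₃.eval x = 0 →
      V'.toAffine.Nonsingular (X' x) (Y' x y) := fun h hx =>
    (Affine.equation_iff_nonsingular (W := V')).mp (hEq _ _ h.left hx)
  -- the map on points: `O ↦ O`, `(x, y) ↦ (X' x, Y' x y)` on `3`-division abscissae (junk `O` else)
  let fpt : V.toAffine.Point → V'.toAffine.Point := fun P =>
    match P with
    | .zero => 0
    | .some x y h => if hx : V.Ψ₃.eval x = 0 then .some (X' x) (Y' x y) (himNS h hx) else 0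
  have fpt_zero : fpt 0 = 0 := rfl
  have fpt_some : ∀ {x y : AlgebraicClosure K} (h : V.toAffine.Nonsingular x y)
      (hx : V.Ψ₃.eval x = 0), fpt (.some x y h) = .some (X' x) (Y' x y) (himNS h hx) := by
    intro x y h hx
    show (if hx : V.Ψ₃.eval x = 0 then _ else _) = _
    rw [dif_pos hx]
  -- facts about points of order 3
  have tors : ∀ {x y : AlgebraicClosure K} (h : V.toAffine.Nonsingular x y),
      (3 : ℤ) • (Affine.Point.some x y h : V.toAffine.Point) = 0 → y ≠ 0 ∧ V.Ψ₃.eval x = 0 :=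
    fun h h3 => eval_Ψ₃_eq_zero_of_three_smul W hW1 hW3 h h3
  -- `fpt` maps `E[3]` into `E'[3]`
  have fpt_tors : ∀ {P : V.toAffine.Point}, (3 : ℤ) • P = 0 → (3 : ℤ) • fpt P = 0 := by
    intro P hP
    rcases P with _ | ⟨x, y, h⟩
    · rw [← Affine.Point.zero_def, fpt_zero, zsmul_zero]
    · obtain ⟨hy, hx⟩ := tors h hP
      rw [fpt_some h hx]
      refine three_smul_eq_zero_of_eval_Ψ₃ W' hW'1 hW'3 (himNS h hx) ?_ (hΨ _ hx)
      exact div_ne_zero (mul_ne_zero hc' hy) (hden _ hx)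
  -- `fpt` commutes with negation on `E[3]`
  have fpt_neg : ∀ {P : V.toAffine.Point}, (3 : ℤ) • P = 0 → fpt (-P) = -fpt P := by
    intro P hP
    rcases P with _ | ⟨x, y, h⟩
    · rw [← Affine.Point.zero_def, neg_zero, fpt_zero, neg_zero]
    · obtain ⟨-, hx⟩ := tors h hP
      rw [Affine.Point.neg_some, fpt_some ((Affine.nonsingular_neg ..).mpr h) hx, fpt_some h hx,
        Affine.Point.neg_some]
      simp only [negY_V, negY_V', Y'_neg]
  -- `fpt` is injective on `E[3]`
  have fpt_inj : ∀ {P Q : V.toAffine.Point}, (3 : ℤ) • P = 0 → (3 : ℤ) • Q = 0 →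
      fpt P = fpt Q → P = Q := by
    intro P Q hP hQ hPQ
    rcases P with _ | ⟨x₁, y₁, h₁⟩ <;> rcases Q with _ | ⟨x₂, y₂, h₂⟩
    · rfl
    · obtain ⟨-, hx₂⟩ := tors h₂ hQ
      rw [← Affine.Point.zero_def, fpt_zero, fpt_some h₂ hx₂] at hPQ
      exact absurd hPQ.symm (Affine.Point.some_ne_zero _)
    · obtain ⟨-, hx₁⟩ := tors h₁ hP
      rw [← Affine.Point.zero_def, fpt_zero, fpt_some h₁ hx₁] at hPQ
      exact absurd hPQ (Affine.Point.some_ne_zero _)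
    · obtain ⟨-, hx₁⟩ := tors h₁ hP
      obtain ⟨-, hx₂⟩ := tors h₂ hQ
      rw [fpt_some h₁ hx₁, fpt_some h₂ hx₂] at hPQ
      simp only [Affine.Point.some.injEq] at hPQ
      obtain ⟨hx12, hy12⟩ := hPQ
      have hxx : x₁ = x₂ := hinj _ _ hx₁ hx₂ hx12
      subst hxx
      have hyy : y₁ = y₂ := by
        have hD := hden _ hx₁
        simp only [hY'] at hy12
        rw [div_left_inj' hD] at hy12
        exact mul_left_cancel₀ hc' hy12
      subst hyy
      rfl
  -- `fpt` is additive on `E[3]`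
  have fpt_add : ∀ {P Q : V.toAffine.Point}, (3 : ℤ) • P = 0 → (3 : ℤ) • Q = 0 →
      fpt (P + Q) = fpt P + fpt Q := by
    intro P Q hP3 hQ3
    rcases P with _ | ⟨x₁, y₁, h₁⟩
    · rw [← Affine.Point.zero_def, fpt_zero, zero_add, zero_add]
    rcases Q with _ | ⟨x₂, y₂, h₂⟩
    · rw [← Affine.Point.zero_def, fpt_zero, add_zero, add_zero]
    obtain ⟨hy₁, hx₁⟩ := tors h₁ hP3
    obtain ⟨hy₂, hx₂⟩ := tors h₂ hQ3
    by_cases hx : x₁ = x₂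
    · -- `Q = P` or `Q = -P`
      subst hx
      rcases Affine.Y_eq_of_X_eq h₂.left h₁.left rfl with hy | hy
      · subst hy
        rw [add_self_eq_neg_of_three_smul' hP3, fpt_neg hP3,
          add_self_eq_neg_of_three_smul' (fpt_tors hP3)]
      · have hQP : (Affine.Point.some x₁ y₂ h₂ : V.toAffine.Point) =
            -(Affine.Point.some x₁ y₁ h₁) := by
          rw [Affine.Point.neg_some]
          simp only [hy]
        rw [hQP, add_neg_cancel, fpt_neg hP3, add_neg_cancel, fpt_zero]
    · -- generic case: `R = -(P + Q)` is the third point of the torsion line `PQ`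
      set L := V.toAffine.slope x₁ x₂ y₁ y₂ with hL
      set x₃ := V.toAffine.addX x₁ x₂ L with hx₃
      set y₃ := V.toAffine.negAddY x₁ x₂ y₁ L with hy₃
      have h₃ : V.toAffine.Nonsingular x₃ y₃ :=
        Affine.nonsingular_negAdd h₁ h₂ fun hxy => hx hxy.left
      have hR : -((Affine.Point.some x₁ y₁ h₁ : V.toAffine.Point) + Affine.Point.some x₂ y₂ h₂) =
          Affine.Point.some x₃ y₃ h₃ := Affine.neg_add_eq_some_addX_negAddY hx
      have hR3 : (3 : ℤ) • (Affine.Point.some x₃ y₃ h₃ : V.toAffine.Point) = 0 := by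
        rw [← hR, zsmul_neg, zsmul_add, hP3, hQ3, add_zero, neg_zero]
      obtain ⟨hy₃', hx₃'⟩ := tors h₃ hR3
      -- `x₃ ∉ {x₁, x₂}`: otherwise `R = ±P` or `R = ±Q`, impossible in `E[3]` with `P ≠ ±Q`
      have h31 : x₃ ≠ x₁ := by
        intro h31
        rcases Affine.Y_eq_of_X_eq h₃.left h₁.left h31 with hyy | hyy
        · have hRP : (Affine.Point.some x₃ y₃ h₃ : V.toAffine.Point) =
              Affine.Point.some x₁ y₁ h₁ := by
            simp only [Affine.Point.some.injEq]; exact ⟨h31, hyy⟩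
          rw [hRP] at hR
          have := eq_of_neg_add_eq_left' hP3 hR
          simp only [Affine.Point.some.injEq] at this
          exact hx this.1.symm
        · have hRP : (Affine.Point.some x₃ y₃ h₃ : V.toAffine.Point) =
              -Affine.Point.some x₁ y₁ h₁ := by
            rw [Affine.Point.neg_some]
            simp only [Affine.Point.some.injEq]; exact ⟨h31, hyy⟩
          rw [hRP] at hR
          exact absurd (eq_zero_of_neg_add_eq_neg_left' hR) (Affine.Point.some_ne_zero _)
      have h32 : x₃ ≠ x₂ := by
        intro h32
        have hR' : -((Affine.Point.some x₂ y₂ h₂ : V.toAffine.Point) + Affine.Point.some x₁ y₁ h₁) =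
            Affine.Point.some x₃ y₃ h₃ := by rw [add_comm]; exact hR
        rcases Affine.Y_eq_of_X_eq h₃.left h₂.left h32 with hyy | hyy
        · have hRQ : (Affine.Point.some x₃ y₃ h₃ : V.toAffine.Point) =
              Affine.Point.some x₂ y₂ h₂ := by
            simp only [Affine.Point.some.injEq]; exact ⟨h32, hyy⟩
          rw [hRQ] at hR'
          have := eq_of_neg_add_eq_left' hQ3 hR'
          simp only [Affine.Point.some.injEq] at this
          exact hx this.1
        · have hRQ : (Affine.Point.some x₃ y₃ h₃ : V.toAffine.Point) =
              -Affine.Point.some x₂ y₂ h₂ := by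
            rw [Affine.Point.neg_some]
            simp only [Affine.Point.some.injEq]; exact ⟨h32, hyy⟩
          rw [hRQ] at hR'
          exact absurd (eq_zero_of_neg_add_eq_neg_left' hR') (Affine.Point.some_ne_zero _)
      -- the line `PQ : y = L x + t₀`, `t₀ = y₁ − L x₁`
      have hx12' : x₁ - x₂ ≠ 0 := sub_ne_zero.mpr hx
      have hLdef : L = (y₁ - y₂) / (x₁ - x₂) := by rw [hL]; exact Affine.slope_of_X_ne hx
      have hy1 : y₁ = L * x₁ + (y₁ - L * x₁) := by ring
      have hy2 : y₂ = L * x₂ + (y₁ - L * x₁) := by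
        have e : L * (x₁ - x₂) = y₁ - y₂ := by rw [hLdef, div_mul_cancel₀ _ hx12']
        linear_combination e
      have hy3 : y₃ = L * x₃ + (y₁ - L * x₁) := by
        rw [hy₃, Affine.negAddY, ← hx₃]; ring
      -- the three abscissae are roots of `Ψ₃` and of `X³ + AX + B − (LX + t₀)²`
      have hψ : ∀ {x : AlgebraicClosure K}, V.Ψ₃.eval x = 0 →
          3 * x ^ 4 + 6 * V.a₄ * x ^ 2 + 12 * V.a₆ * x - V.a₄ ^ 2 = 0 := fun hx => by
        rwa [eval_Ψ₃_of_short V hV1 hV2 hV3] at hx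
      have hq1 : x₁ ^ 3 + V.a₄ * x₁ + V.a₆ = (L * x₁ + (y₁ - L * x₁)) ^ 2 := by
        rw [← hy1]; exact equation_of_short V hV1 hV2 hV3 h₁.left
      have hq2 : x₂ ^ 3 + V.a₄ * x₂ + V.a₆ = (L * x₂ + (y₁ - L * x₁)) ^ 2 := by
        rw [← hy2]; exact equation_of_short V hV1 hV2 hV3 h₂.left
      have hq3 : x₃ ^ 3 + V.a₄ * x₃ + V.a₆ = (L * x₃ + (y₁ - L * x₁)) ^ 2 := by
        rw [← hy3]; exact equation_of_short V hV1 hV2 hV3 h₃.left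
      have h3K : (3 : AlgebraicClosure K) ≠ 0 := by norm_num
      obtain ⟨hL1, hL2, -⟩ := torsionLine_relations h3K hx (Ne.symm h31) (Ne.symm h32) (hψ hx₁)
        (hψ hx₂) (hψ hx₃') hq1 hq2 hq3
      obtain ⟨s', t', hst⟩ := hline L (y₁ - L * x₁) hL1 hL2
      -- images lie on the line `y' = s' x' + t'`
      have hD₁ := hden _ hx₁
      have hD₂ := hden _ hx₂
      have hD₃ := hden _ hx₃'
      have himline : ∀ {x y : AlgebraicClosure K}, V.Ψ₃.eval x = 0 → y = L * x + (y₁ - L * x₁) →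
          x ^ 3 + V.a₄ * x + V.a₆ = (L * x + (y₁ - L * x₁)) ^ 2 → aeval x D ≠ 0 →
          Y' x y = s' * X' x + t' := by
        intro x y hx hy hq hD
        simp only [hX', hY']
        rw [hy, hst x hx hq]
        field_simp
      have e1 := himline hx₁ hy1 hq1 hD₁
      have e2 := himline hx₂ hy2 hq2 hD₂
      have e3 := himline hx₃' hy3 hq3 hD₃
      have hcol' : (X' x₂ - X' x₁) * (Y' x₃ y₃ - Y' x₁ y₁) = (X' x₃ - X' x₁) * (Y' x₂ y₂ - Y' x₁ y₁) := by
        rw [e1, e2, e3]; ring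
      have hx12'' : X' x₁ ≠ X' x₂ := fun h => hx (hinj _ _ hx₁ hx₂ h)
      have hx31' : X' x₃ ≠ X' x₁ := fun h => h31 (hinj _ _ hx₃' hx₁ h)
      have hx32' : X' x₃ ≠ X' x₂ := fun h => h32 (hinj _ _ hx₃' hx₂ h)
      have key : (Affine.Point.some (X' x₁) (Y' x₁ y₁) (himNS h₁ hx₁) : V'.toAffine.Point) +
          Affine.Point.some (X' x₂) (Y' x₂ y₂) (himNS h₂ hx₂) =
          -Affine.Point.some (X' x₃) (Y' x₃ y₃) (himNS h₃ hx₃') :=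
        Affine.add_eq_neg_of_collinear hx12'' hx31' hx32' hcol'
      -- assemble: f(P+Q) = f(-R) = -f(R) = f P + f Q
      have ePQ : (Affine.Point.some x₁ y₁ h₁ : V.toAffine.Point) + Affine.Point.some x₂ y₂ h₂ =
          -Affine.Point.some x₃ y₃ h₃ := by rw [← hR, neg_neg]
      rw [ePQ, fpt_neg hR3, fpt_some h₃ hx₃', fpt_some h₁ hx₁, fpt_some h₂ hx₂, key]
  -- `fpt` commutes with `Aut(K̄/K)` on `E[3]`
  have fpt_smul : ∀ (τ : (AlgebraicClosure K) ≃ₐ[K] (AlgebraicClosure K)) {P : V.toAffine.Point},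
      (3 : ℤ) • P = 0 → fpt (τ • P) = τ • fpt P := by
    intro τ P hP
    rcases P with _ | ⟨x, y, h⟩
    · rw [← Affine.Point.zero_def, smul_zero, fpt_zero, smul_zero]
    · obtain ⟨-, hx⟩ := tors h hP
      obtain ⟨h', e1⟩ : ∃ h', τ • (Affine.Point.some x y h : V.toAffine.Point) =
          Affine.Point.some (τ x) (τ y) h' := ⟨_, rfl⟩
      have hτx : V.Ψ₃.eval (τ x) = 0 := by
        rw [hV, eval_Ψ₃_baseChange_algEquiv' W τ x, ← hV, hx, map_zero]
      obtain ⟨h'', e2⟩ : ∃ h'', τ • (Affine.Point.some (X' x) (Y' x y) (himNS h hx) : V'.toAffine.Point) =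
          Affine.Point.some (τ (X' x)) (τ (Y' x y)) h'' := ⟨_, rfl⟩
      rw [e1, fpt_some h' hτx, fpt_some h hx, e2]
      simp only [hX', hY', algEquiv_aeval_div, algEquiv_smul_div]
  -- transport to the tree's `geomTorsion` (a subgroup of the type synonym `geomPoints`)
  have mem3 : ∀ {P : geomPoints W}, P ∈ geomTorsion W (3 : ℤ) →
      (3 : ℤ) • (show V.toAffine.Point from P) = 0 := fun hP => (Submodule.mem_torsionBy_iff _ _).mp hP
  have mem3' : ∀ {P : V'.toAffine.Point}, (3 : ℤ) • P = 0 →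
      (show geomPoints W' from P) ∈ geomTorsion W' (3 : ℤ) := fun hP =>
    (Submodule.mem_torsionBy_iff _ _).mpr hP
  let g : geomTorsion W (3 : ℤ) →+ geomTorsion W' (3 : ℤ) :=
    { toFun := fun P => ⟨fpt P.1, mem3' (fpt_tors (mem3 P.2))⟩
      map_zero' := Subtype.ext fpt_zero
      map_add' := fun P Q => Subtype.ext (fpt_add (mem3 P.2) (mem3 Q.2)) }
  have g_inj : Function.Injective g := fun P Q h =>
    Subtype.ext (fpt_inj (mem3 P.2) (mem3 Q.2) (congrArg Subtype.val h))
  -- cardinalities: `#E[3] = #E'[3] = 9`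
  have h3 : ((3 : ℕ) : AlgebraicClosure K) ≠ 0 := by norm_num
  have hcardW : Nat.card (geomTorsion W (3 : ℤ)) = 3 ^ 2 :=
    card_torsionPoints_eq_sq_holds W (AlgebraicClosure K) (n := 3) h3
  have hcardW' : Nat.card (geomTorsion W' (3 : ℤ)) = 3 ^ 2 :=
    card_torsionPoints_eq_sq_holds W' (AlgebraicClosure K) (n := 3) h3
  haveI : Finite (geomTorsion W' (3 : ℤ)) := Nat.finite_of_card_ne_zero (by rw [hcardW']; norm_num)
  have g_bij : Function.Bijective g :=
    g_inj.bijective_of_nat_card_le (by rw [hcardW, hcardW'])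
  refine ⟨AddEquiv.ofBijective g g_bij, fun σ P => ?_⟩
  -- equivariance
  apply Subtype.ext
  change fpt (show V.toAffine.Point from ((σ • P : geomTorsion W (3 : ℤ)) : geomPoints W)) =
    (Field.absoluteGaloisGroup.toAlgEquiv K σ) • fpt P.1
  exact fpt_smul (Field.absoluteGaloisGroup.toAlgEquiv K σ) (mem3 P.2)

end Transfer

end Literature.NumberTheory.EllipticCurves.Fisher2012
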